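import Summits.Ventures.CertifiedManyBodySolver.Observables.EtaPairingExclusionBelowQuarterFilling
import Summits.Ventures.CertifiedManyBodySolver.Certificates.HubbardSquare_U1o8_n7o8_tp0_lower_row538
import Literature.MathematicalPhysics.QuantumLattice.HubbardFermiSeaCellRows
import Literature.MathematicalPhysics.QuantumLattice.HubbardFermiSeaTangentRowsLow
import HarnessLib

/-!
# η-PAIRING ODLRO IS EXCLUDED IN EXPLICIT WEAK-COUPLING WINDOWS ABOVE QUARTER FILLING (`t' = 0`) — kernel Fermi-sea
# rows only — and at the two small-`U` atlas cells `(1/32, 7/8, 0)` (premise-free) and `(1/8, 7/8, 0)` (node #538)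

HONEST FRAMING: exclusions in Yang's staggered `s`-wave (η) pair channel, where nobody expects order; NOTHING about `d`-wave
pairing or the uniform on-site channel; CTL/dictionary class; a ceiling never speaks to presence; not a superconductivity
verdict; no phase sentence. Crew hubbard-obs (D-0042), seat hubbard-obs-p1 (`prover-hubbard-obs-p1-g15-0`); part 2 of
`EtaPairingExclusionBelowQuarterFilling` (the one-body secant `U − 2μ₊(n;U) ≥ (U(1 − 2n) + 4(ℓ + 16/π²))/(2(1 − n))` and its
generic window form `etaPairing_exclusion_of_floor`). ZERO compute; no definition; no `sorry`.

* §4 With the kernel Fermi-sea rows (`HubbardFermiSeaCellRows`, `HubbardFermiSeaTangentRowsLow`; `M = 64`, uniform in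
  `U ≥ 0`) the free compressibility gain `g(n) = ℓ(n) + 16/π² > 0` buys the WEAK-COUPLING windows `U < 4g(n)/(2n − 1)`:
  margins `n = 7/10: 0.6183229 − (2/3)U` (`U < 0.927`), `3/4: 0.4846219 − U`, `4/5: 0.3554350 − (3/2)U` (`U < 0.23695`),
  `7/8: 0.1723948 − 3U` (`U < 0.057465`); in each window every translation-invariant ground state of that density has NO
  η-pairing ODLRO, `Re ω(η†_Λ η_Λ) ≤ 64(|Λ'| − |Λ|)²/margin²`.
* §5 the two small-`U` cells of the mbsolver atlas at `n = 7/8` (CERTIFIED #537 / #538, 2026-08-27): `(1/32, 7/8, 0)` lies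
  INSIDE the premise-free window (margin `0.0786448`; #537's floor `−1.6112604` is looser than the kernel Fermi-sea row
  `−1.6103642` there and is not used); `(1/8, 7/8, 0)` lies outside it and is closed by the claim node #538 BY NAME
  (`ℓ = −1927332612054796014970025/2⁸⁰ = −1.5942522`, margin `≥ 0.0551876`).

CITATION FORM: as part 1 — [folklore: Yang 1989 commutator + Bratteli–Robinson ground-state stability; no printed
infinite-volume statement located (obs-lit g10 / p1 g13 / p1 g15 presearch, corpus + galaxy)]; the `[cite:]` tags name the
INGREDIENTS. References: C. N. Yang, PRL 63 (1989) 2144 [Yang1989]; O. Bratteli, D. W. Robinson, OAQSM 2 (1997)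
Prop. 5.3.19 [BratteliRobinsonII1997]; E. H. Lieb, M. Loss, Duke Math. J. 71 (1993) 337, §8 [LiebLoss1993]; E. H. Lieb,
F. Y. Wu, Physica A 321 (2003) 1, §7 [LiebWuPhysicaA2003].
-/

noncomputable section

namespace Summit.Ventures.CertifiedManyBodySolver.Observables

open Matrix Finset Filter Literature.MathematicalPhysics.QuantumLattice Literature.Probability.LatticeModels
open Literature.MathematicalPhysics.QuantumLattice.HubbardWave0 ThermodynamicLimit
open Summit.Ventures.CertifiedManyBodySolver.Certificates
open scoped ComplexOrder Topology

/-! ### §4 WEAK-COUPLING WINDOWS above quarter filling from the kernel Fermi-sea rows (`M = 64`, uniform in `U ≥ 0`) -/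

/-- **Margin at `n = 7/10`**: `U − 2μ₊(7/10; U) ≥ 0.6183229 − (2/3)U` (floor = the tangent Fermi-sea row touching at `7/10`,
`fermiSeaTangentRow_tPrime_zero_at_seven_div_ten`: `−1.5283904621375 ≤ e(1,0,U,7/10)`); positive iff `U < 0.92748435`.
[cite: LiebWuPhysicaA2003, §7] [cite: LiebLoss1993, §8, Theorem 8.2] -/
theorem sub_two_mul_chemPotPlusTT'_n7o10_ge {U : ℝ} (hU : 0 ≤ U) :
    (0.6183229 : ℝ) - 2 / 3 * U ≤ U - 2 * chemPotPlusTT' 1 0 U (7 / 10) := by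
  have hℓ := fermiSeaTangentRow_tPrime_zero_at_seven_div_ten hU (n := 7 / 10) (by norm_num) (by norm_num)
  have h := sub_two_mul_chemPotPlusTT'_ge_of_floor_decimal hU (n := 7 / 10) (by norm_num) (by norm_num) hℓ
  norm_num at h ⊢
  linarith

/-- **Margin at `n = 3/4`**: `U − 2μ₊(3/4; U) ≥ 0.4846219 − U` (floor `fermiSeaCellRow_tPrime_zero_density_three_div_four`:
`−1.5605611532 ≤ e(1,0,U,3/4)`); positive iff `U < 0.4846219`. [cite: LiebWuPhysicaA2003, §7] [cite: LiebLoss1993, §8, Theorem 8.2] -/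
theorem sub_two_mul_chemPotPlusTT'_n3o4_ge {U : ℝ} (hU : 0 ≤ U) :
    (0.4846219 : ℝ) - U ≤ U - 2 * chemPotPlusTT' 1 0 U (3 / 4) := by
  have hℓ := fermiSeaCellRow_tPrime_zero_density_three_div_four hU
  have h := sub_two_mul_chemPotPlusTT'_ge_of_floor_decimal hU (n := 3 / 4) (by norm_num) (by norm_num) hℓ
  norm_num at h ⊢
  linarith

/-- **Margin at `n = 4/5`**: `U − 2μ₊(4/5; U) ≥ 0.3554350 − (3/2)U` (floor `fermiSeaCellRow_tPrime_zero_density_four_div_five`: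
`−1.5855953908 ≤ e(1,0,U,4/5)`); positive iff `U < 0.23695`. [cite: LiebWuPhysicaA2003, §7] [cite: LiebLoss1993, §8, Theorem 8.2] -/
theorem sub_two_mul_chemPotPlusTT'_n4o5_ge {U : ℝ} (hU : 0 ≤ U) :
    (0.3554350 : ℝ) - 3 / 2 * U ≤ U - 2 * chemPotPlusTT' 1 0 U (4 / 5) := by
  have hℓ := fermiSeaCellRow_tPrime_zero_density_four_div_five hU
  have h := sub_two_mul_chemPotPlusTT'_ge_of_floor_decimal hU (n := 4 / 5) (by norm_num) (by norm_num) hℓ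
  norm_num at h ⊢
  linarith

/-- **Margin at `n = 7/8`**: `U − 2μ₊(7/8; U) ≥ 0.1723948 − 3U` (floor `fermiSeaCellRow_tPrime_zero_density_seven_div_eight`:
`−1.6103642235 ≤ e(1,0,U,7/8)`); positive iff `U < 0.0574649`. [cite: LiebWuPhysicaA2003, §7] [cite: LiebLoss1993, §8, Theorem 8.2] -/
theorem sub_two_mul_chemPotPlusTT'_n7o8_ge {U : ℝ} (hU : 0 ≤ U) :
    (0.1723948 : ℝ) - 3 * U ≤ U - 2 * chemPotPlusTT' 1 0 U (7 / 8) := by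
  have hℓ := fermiSeaCellRow_tPrime_zero_density_seven_div_eight hU
  have h := sub_two_mul_chemPotPlusTT'_ge_of_floor_decimal hU (n := 7 / 8) (by norm_num) (by norm_num) hℓ
  norm_num at h ⊢
  linarith

/-- **η-PAIRING ODLRO IS ABSENT IN THE WEAK-COUPLING WINDOW AT `n = 3/4`**: for `0 ≤ U < 0.4846219`, every
translation-invariant ground state of density `3/4` has `M⁻⁴ Re ω(η†η) → 0` and `Re ω(η†_Λ η_Λ) ≤ 64(|Λ'| − |Λ|)²/(0.4846219 − U)²`.
[cite: Yang1989, eqs. (6)–(8)] [cite: BratteliRobinsonII1997, Prop. 5.3.19] -/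
theorem etaPairing_exclusion_n3o4_weakCoupling {U : ℝ} (hU : 0 ≤ U) (hUw : U < 0.4846219)
    {ω : InfVolFermionState 2} (hω : ω.IsTranslationInvariant) (hρ : ω.density = 3 / 4)
    (hme : ω.meanEnergy (hubbardTTPrimeFermionInteraction 1 0 U) 1 = energyDensityTT' 1 0 U (3 / 4)) :
    Tendsto (fun M : ℕ =>
        (ω.expect (halfOpenBox 2 M) (etaRaise (fun w : PolySite (halfOpenBox 2 M) => siteStagger (ofLex w.1)) *
          etaLower (fun w : PolySite (halfOpenBox 2 M) => siteStagger (ofLex w.1)))).re / (M : ℝ) ^ 4)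
        atTop (𝓝 0) ∧
      ∀ {Λ Λ' : Finset (Site 2)}, Λ ⊆ Λ' → thicken Λ 1 ⊆ Λ' →
        (ω.expect Λ (etaRaise (fun w : PolySite Λ => siteStagger (ofLex w.1)) *
            etaLower (fun w : PolySite Λ => siteStagger (ofLex w.1)))).re ≤
          64 * ((#Λ' : ℝ) - #Λ) ^ 2 / ((0.4846219 : ℝ) - U) ^ 2 := by
  have hgap := sub_two_mul_chemPotPlusTT'_n3o4_ge hU
  have hmpos : (0 : ℝ) < 0.4846219 - U := by linarith
  refine ⟨tendsto_etaPairing_boxLRO_of_chemPotPlus_lt hU (by norm_num) (by norm_num) (by linarith) hω hρ hme,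
    fun hΛ h8 => ?_⟩
  have h := re_expect_etaRaise_mul_etaLower_le_of_chemPotPlus_le (U := U) (n := 3 / 4)
    (m := chemPotPlusTT' 1 0 U (3 / 4)) hU (by norm_num) (by norm_num) le_rfl (by linarith) hω hρ hme hΛ h8
  refine h.trans (div_le_div_of_nonneg_left (by positivity) (by positivity) ?_)
  exact pow_le_pow_left₀ hmpos.le hgap 2

/-- **η-PAIRING ODLRO IS ABSENT IN THE WEAK-COUPLING WINDOW AT `n = 4/5`**: `0 ≤ U < 0.2369566` ⇒ margin `0.3554350 − (3/2)U`.
[cite: Yang1989, eqs. (6)–(8)] [cite: BratteliRobinsonII1997, Prop. 5.3.19] -/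
theorem etaPairing_exclusion_n4o5_weakCoupling {U : ℝ} (hU : 0 ≤ U) (hUw : U < 0.2369566)
    {ω : InfVolFermionState 2} (hω : ω.IsTranslationInvariant) (hρ : ω.density = 4 / 5)
    (hme : ω.meanEnergy (hubbardTTPrimeFermionInteraction 1 0 U) 1 = energyDensityTT' 1 0 U (4 / 5)) :
    Tendsto (fun M : ℕ =>
        (ω.expect (halfOpenBox 2 M) (etaRaise (fun w : PolySite (halfOpenBox 2 M) => siteStagger (ofLex w.1)) *
          etaLower (fun w : PolySite (halfOpenBox 2 M) => siteStagger (ofLex w.1)))).re / (M : ℝ) ^ 4)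
        atTop (𝓝 0) ∧
      ∀ {Λ Λ' : Finset (Site 2)}, Λ ⊆ Λ' → thicken Λ 1 ⊆ Λ' →
        (ω.expect Λ (etaRaise (fun w : PolySite Λ => siteStagger (ofLex w.1)) *
            etaLower (fun w : PolySite Λ => siteStagger (ofLex w.1)))).re ≤
          64 * ((#Λ' : ℝ) - #Λ) ^ 2 / ((0.3554350 : ℝ) - 3 / 2 * U) ^ 2 := by
  have hgap := sub_two_mul_chemPotPlusTT'_n4o5_ge hU
  have hmpos : (0 : ℝ) < 0.3554350 - 3 / 2 * U := by linarith
  refine ⟨tendsto_etaPairing_boxLRO_of_chemPotPlus_lt hU (by norm_num) (by norm_num) (by linarith) hω hρ hme,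
    fun hΛ h8 => ?_⟩
  have h := re_expect_etaRaise_mul_etaLower_le_of_chemPotPlus_le (U := U) (n := 4 / 5)
    (m := chemPotPlusTT' 1 0 U (4 / 5)) hU (by norm_num) (by norm_num) le_rfl (by linarith) hω hρ hme hΛ h8
  refine h.trans (div_le_div_of_nonneg_left (by positivity) (by positivity) ?_)
  exact pow_le_pow_left₀ hmpos.le hgap 2

/-- **η-PAIRING ODLRO IS ABSENT IN THE WEAK-COUPLING WINDOW AT `n = 7/8`**: `0 ≤ U < 0.0574649` ⇒ margin `0.1723948 − 3U`.
[cite: Yang1989, eqs. (6)–(8)] [cite: BratteliRobinsonII1997, Prop. 5.3.19] -/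
theorem etaPairing_exclusion_n7o8_weakCoupling {U : ℝ} (hU : 0 ≤ U) (hUw : U < 0.0574649)
    {ω : InfVolFermionState 2} (hω : ω.IsTranslationInvariant) (hρ : ω.density = 7 / 8)
    (hme : ω.meanEnergy (hubbardTTPrimeFermionInteraction 1 0 U) 1 = energyDensityTT' 1 0 U (7 / 8)) :
    Tendsto (fun M : ℕ =>
        (ω.expect (halfOpenBox 2 M) (etaRaise (fun w : PolySite (halfOpenBox 2 M) => siteStagger (ofLex w.1)) *
          etaLower (fun w : PolySite (halfOpenBox 2 M) => siteStagger (ofLex w.1)))).re / (M : ℝ) ^ 4)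
        atTop (𝓝 0) ∧
      ∀ {Λ Λ' : Finset (Site 2)}, Λ ⊆ Λ' → thicken Λ 1 ⊆ Λ' →
        (ω.expect Λ (etaRaise (fun w : PolySite Λ => siteStagger (ofLex w.1)) *
            etaLower (fun w : PolySite Λ => siteStagger (ofLex w.1)))).re ≤
          64 * ((#Λ' : ℝ) - #Λ) ^ 2 / ((0.1723948 : ℝ) - 3 * U) ^ 2 := by
  have hgap := sub_two_mul_chemPotPlusTT'_n7o8_ge hU
  have hmpos : (0 : ℝ) < 0.1723948 - 3 * U := by linarith
  refine ⟨tendsto_etaPairing_boxLRO_of_chemPotPlus_lt hU (by norm_num) (by norm_num) (by linarith) hω hρ hme,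
    fun hΛ h8 => ?_⟩
  have h := re_expect_etaRaise_mul_etaLower_le_of_chemPotPlus_le (U := U) (n := 7 / 8)
    (m := chemPotPlusTT' 1 0 U (7 / 8)) hU (by norm_num) (by norm_num) le_rfl (by linarith) hω hρ hme hΛ h8
  refine h.trans (div_le_div_of_nonneg_left (by positivity) (by positivity) ?_)
  exact pow_le_pow_left₀ hmpos.le hgap 2

/-! ### §5 Two small-`U` atlas cells at `n = 7/8`: `(1/32, 7/8, 0)` premise-free, `(1/8, 7/8, 0)` from node #538 BY NAME -/

/-- **η-PAIRING ODLRO IS ABSENT at the atlas cell `(1/32, 7/8, 0)` — premise-free** (inside the §4 window; margin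
`0.1723948 − 3/32 = 0.0786448`; CERTIFIED #537's floor is not needed). [cite: Yang1989, eqs. (6)–(8)]
[cite: BratteliRobinsonII1997, Prop. 5.3.19] -/
theorem etaPairing_exclusion_U1o32_n7o8_tp0
    {ω : InfVolFermionState 2} (hω : ω.IsTranslationInvariant) (hρ : ω.density = 7 / 8)
    (hme : ω.meanEnergy (hubbardTTPrimeFermionInteraction 1 0 (1 / 32)) 1 = energyDensityTT' 1 0 (1 / 32) (7 / 8)) :
    Tendsto (fun M : ℕ =>
        (ω.expect (halfOpenBox 2 M) (etaRaise (fun w : PolySite (halfOpenBox 2 M) => siteStagger (ofLex w.1)) *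
          etaLower (fun w : PolySite (halfOpenBox 2 M) => siteStagger (ofLex w.1)))).re / (M : ℝ) ^ 4)
        atTop (𝓝 0) ∧
      ∀ {Λ Λ' : Finset (Site 2)}, Λ ⊆ Λ' → thicken Λ 1 ⊆ Λ' →
        (ω.expect Λ (etaRaise (fun w : PolySite Λ => siteStagger (ofLex w.1)) *
            etaLower (fun w : PolySite Λ => siteStagger (ofLex w.1)))).re ≤
          64 * ((#Λ' : ℝ) - #Λ) ^ 2 / (0.0786448 : ℝ) ^ 2 := by
  have h := etaPairing_exclusion_n7o8_weakCoupling (U := 1 / 32) (by norm_num) (by norm_num) hω hρ hme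
  refine ⟨h.1, fun hΛ h8 => (h.2 hΛ h8).trans (le_of_eq ?_)⟩
  norm_num

/-- **`1/8 − 2μ₊(7/8; 1/8) ≥ 0.0551876`** from the claim node #538 BY NAME (`−1927332612054796014970025/2⁸⁰ ≤ e(1,0,1/8,7/8)`;
the premise-free window of §4 stops at `U = 0.0574649 < 1/8`). [cite: LiebWuPhysicaA2003, §7] -/
theorem sub_two_mul_chemPotPlusTT'_U1o8_n7o8_tp0_ge (h538 : cert_r538_bs_GU1o8n7o8tp0_A4psU1o8_uprime) :
    (0.0551876 : ℝ) ≤ 1 / 8 - 2 * chemPotPlusTT' 1 0 (1 / 8) (7 / 8) := by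
  have hℓ : (((-1927332612054796014970025/1208925819614629174706176 : ℚ)) : ℝ) ≤
      energyDensityTT' 1 0 (1 / 8) (7 / 8) := h538
  have h := sub_two_mul_chemPotPlusTT'_ge_of_floor_decimal (U := 1 / 8) (n := 7 / 8) (by norm_num) (by norm_num)
    (by norm_num) hℓ
  have hnum : (0.0551876 : ℝ) ≤ (1 / 8 * (1 - 2 * (7 / 8 : ℝ)) +
      4 * ((((-1927332612054796014970025/1208925819614629174706176 : ℚ)) : ℝ) + 1.6211389)) / (2 * (1 - 7 / 8)) := by
    norm_num
  exact hnum.trans h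

/-- **η-PAIRING ODLRO IS ABSENT at the atlas cell `(1/8, 7/8, 0)`** (node #538 BY NAME): for every translation-invariant
ground state of density `7/8` at `U = 1/8`, `M⁻⁴ Re ω(η†η) → 0` and `Re ω(η†_Λ η_Λ) ≤ 64(|Λ'| − |Λ|)²/0.0551876²`.
[cite: Yang1989, eqs. (6)–(8)] [cite: BratteliRobinsonII1997, Prop. 5.3.19] -/
theorem etaPairing_exclusion_U1o8_n7o8_tp0 (h538 : cert_r538_bs_GU1o8n7o8tp0_A4psU1o8_uprime)
    {ω : InfVolFermionState 2} (hω : ω.IsTranslationInvariant) (hρ : ω.density = 7 / 8)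
    (hme : ω.meanEnergy (hubbardTTPrimeFermionInteraction 1 0 (1 / 8)) 1 = energyDensityTT' 1 0 (1 / 8) (7 / 8)) :
    Tendsto (fun M : ℕ =>
        (ω.expect (halfOpenBox 2 M) (etaRaise (fun w : PolySite (halfOpenBox 2 M) => siteStagger (ofLex w.1)) *
          etaLower (fun w : PolySite (halfOpenBox 2 M) => siteStagger (ofLex w.1)))).re / (M : ℝ) ^ 4)
        atTop (𝓝 0) ∧
      ∀ {Λ Λ' : Finset (Site 2)}, Λ ⊆ Λ' → thicken Λ 1 ⊆ Λ' →
        (ω.expect Λ (etaRaise (fun w : PolySite Λ => siteStagger (ofLex w.1)) *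
            etaLower (fun w : PolySite Λ => siteStagger (ofLex w.1)))).re ≤
          64 * ((#Λ' : ℝ) - #Λ) ^ 2 / (0.0551876 : ℝ) ^ 2 := by
  have hgap := sub_two_mul_chemPotPlusTT'_U1o8_n7o8_tp0_ge h538
  refine ⟨tendsto_etaPairing_boxLRO_of_chemPotPlus_lt (U := 1 / 8) (by norm_num) (by norm_num) (by norm_num)
    (by linarith) hω hρ hme, fun hΛ h8 => ?_⟩
  have h := re_expect_etaRaise_mul_etaLower_le_of_chemPotPlus_le (U := 1 / 8) (n := 7 / 8)
    (m := chemPotPlusTT' 1 0 (1 / 8) (7 / 8)) (by norm_num) (by norm_num) (by norm_num) le_rfl (by linarith)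
    hω hρ hme hΛ h8
  refine h.trans (div_le_div_of_nonneg_left (by positivity) (by positivity) ?_)
  exact pow_le_pow_left₀ (by norm_num) hgap 2

end Summit.Ventures.CertifiedManyBodySolver.Observables

end
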